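import Summits.Langlands.Langlands.Theses.LiftDescend
import Summits.Langlands.Langlands.Theorems.OrdinaryPrimeTransportReciprocityUpToIrreducibilityRankOneAwayUnramified
import Literature.NumberTheory.Automorphic.CarayolCompatibilityOfLocalGlobalGLnProofs
import Literature.NumberTheory.GaloisRepresentations.AbsGaloisGroupCompact
import Mathlib.LinearAlgebra.Eigenspace.Charpoly
import Mathlib.Analysis.Normed.Group.Bounded
import Mathlib.Topology.Instances.Matrix
import Literature.FieldTheory.AlgClosed.AutomorphismExtension
import Literature.FieldTheory.AlgClosed.PadicAlgClEquivComplex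
import HarnessLib

/-!
# `LiftDescend.LArithmeticOfAutToGal` — proved outright (hidden arithmeticity of the `∀ ι` statement)

Item `stmt-Langlands-1066` (support, rank 9, route `LiftDescend`): for every number field `F`,
reciprocity data `R`, rank `n` and level-compactness witness `hcpt`, **direction (A)
`AutomorphicToGalois n R hcpt` — quantified over ALL field isomorphisms `ι : ℚ̄_ℓ ≃ ℂ` — forces the
Satake parameters of every L-algebraic cuspidal `π` of `GL_n(𝔸_F)` to be algebraic numbers at all
but finitely many places** (Buzzard–Gee L-arithmeticity, Conj. 3.1.6, is a conjunct of the typed summit;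
this is the implication "Conj. 3.2.1 for all `ι` ⇒ Conj. 3.1.6" away from `ℓ`).

## Proof

Fix the prime `ℓ = 2`; the exceptional set is `{v : 2 ∈ v}` (finite,
`FramedGaloisRep.eventually_natCast_not_mem`).  Let `v ∤ 2`, `α` a Satake parameter of `π` at `v`
and `a ∈ α`.

* **Unit bound, for EVERY `ι`, rank `n ≥ 2`.**  The `ρ = ρ_{π,ι}` of (A) is locally–globally
  compatible with `π` at EVERY finite place, in particular at `v ∤ ℓ`: the Grothendieck–Deligne recipe
  attaches `r_v` to `ρ|_{W_{F_v}}` with a recipe Frobenius `Φ` (`deg Φ = -1`) at which — the inertial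
  parameter being `u = 1` — the matrix of `r_v.ρ(Φ)` IS `ρ(Φ)`; its transport `rℂ = ι(r_v)` has
  Frobenius-semisimplification `r'` of class `rec_v(π_v)`, and by the UNCONDITIONAL rank-`n` unramified
  computation of `rec_v` at the generic unramified local component `π_v`
  (`LocalLanglandsDatum.recGL_unramified_of_hasSatakeParamAt`: Jacquet–Shalika divisibility + clause
  (iii-L) of the local Langlands datum) `char(r'.ρ Φ) = ∏_{b ∈ α} (X - b)`; F-semisimplification does not
  change characteristic polynomials (`LinearMap.charpoly_add_eq_of_isNilpotent_of_commute`).  Hence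
  `ι(char ρ(Φ)) = ∏ (X - b)`, so `ι⁻¹(a)` is an eigenvalue of `ρ(Φ)`, an element of the compact group
  `ρ(Γ_F) ⊂ GL_n(ℚ̄₂)`, and `‖ι⁻¹(a)‖ ≤ 1` (`norm_le_one_of_isRoot_charpoly_lar`, Serre Ch. I §1.1;
  `absoluteGaloisGroup_compactSpace`).
* **Rank `1`.**  Weil's `ℓ`-adic character of the (algebraic) Hecke character of `π`
  (`stub_rankOne_corresponds_away_unramified`; (A) is not even needed) is Satake–Frobenius compatible
  at `v`, so `ι⁻¹(a⁻¹)` is a root of `char ρ(Frob_v^{arith}) = arithFrobPolyOfSatake ι q_v 1 α`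
  (Satake uniqueness `hasSatakeParamAt_unique_holds`; a Frobenius exists by `primesAbove_nonempty`,
  `exists_isArithFrobAt_of_mem_primesAbove_holds`), whence `‖ι⁻¹(a⁻¹)‖ ≤ 1`.  Rank `0` cannot occur
  (`card α = n`, `a ∈ α`).
* **Steinitz.**  If `b ∈ ℂ` has `‖ι⁻¹(b)‖ ≤ 1` for EVERY `ι` then `b` is algebraic: otherwise `b` and
  `c = b / ℓ^k` are transcendental, `Aut(ℂ)` is transitive on transcendentals (tree
  `Complex.exists_ringEquiv_apply_eq_of_transcendental`), so some `σ ∈ Aut(ℂ)` has `σ(c) = b`, and for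
  `ι' = σ ∘ ι₀` (any `ι₀`, `PadicAlgCl.nonempty_ringEquiv_complex`) `ι'⁻¹(b) = ι₀⁻¹(b) / ℓ^k` has norm
  `‖ι₀⁻¹(b)‖ · ℓ^k > 1` for `k` large.  Applied to `b = a` (rank `≥ 2`) and `b = a⁻¹` (rank `1`).

No named Literature fact is consumed as a hypothesis; no definitions; standard axioms.  The unit-eigenvalue
lemma for compact-image representations is re-proved here (private, suffix `_lar`; same argument as the
tree's `Literature/NumberTheory/GaloisRepresentations/CompactImageCharpolyIntegral.lean`, which is not in
this file's import closure).
decomp-langlands lens-6 g29 proof twin, 2026-08-31.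
-/

noncomputable section

set_option linter.dupNamespace false -- project-wide option; `Summit.Langlands.Langlands` is the mandated namespace

open scoped MatrixGroups Matrix NumberField Classical Polynomial NNReal
open Filter IsDedekindDomain Field Polynomial
open Literature.NumberTheory.Automorphic Literature.NumberTheory.GaloisRepresentations
open Summit.Langlands
open Summit.Langlands.Langlands.Theorems.ReciprocityUpToIrreducibility

namespace Summit.Langlands.Langlands.Theorems

namespace LArithmeticOfAutToGal

/-! ### Steinitz step: an element of `ℂ` all of whose `Aut(ℂ)`-twisted `ℓ`-adic avatars are integral is algebraic -/

/-- `‖ℓ‖ = ℓ⁻¹` in `ℚ̄_ℓ`. [folklore] -/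
theorem norm_natCast_padicAlgCl (ℓ : ℕ) [Fact ℓ.Prime] : ‖(ℓ : PadicAlgCl ℓ)‖ = ((ℓ : ℝ))⁻¹ := by
  have h := PadicAlgCl.norm_extends (p := ℓ) (ℓ : ℚ_[ℓ])
  rw [map_natCast, Padic.norm_p] at h
  exact h

/-- **Steinitz.**  If `‖ι⁻¹(b)‖ ≤ 1` for EVERY field isomorphism `ι : ℚ̄_ℓ ≃+* ℂ`, then `b` is algebraic
over `ℚ`: otherwise `b` and `b / ℓ^k` are transcendental, hence conjugate under `Aut(ℂ)`
(`Complex.exists_ringEquiv_apply_eq_of_transcendental`), and twisting any `ι₀` by such a conjugation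
divides `ι₀⁻¹(b) ≠ 0` by `ℓ^k`, of norm `ℓ^{-k}`. [folklore] -/
theorem isAlgebraic_of_forall_norm_symm_le_one (ℓ : ℕ) [Fact ℓ.Prime] {b : ℂ}
    (h : ∀ ι : PadicAlgCl ℓ ≃+* ℂ, ‖ι.symm b‖ ≤ 1) : IsAlgebraic ℚ b := by
  by_contra hb
  have hb0 : b ≠ 0 := fun h0 => hb (h0 ▸ isAlgebraic_zero)
  obtain ⟨ι₀⟩ := PadicAlgCl.nonempty_ringEquiv_complex ℓ
  set x : PadicAlgCl ℓ := ι₀.symm b with hx_def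
  have hx0 : x ≠ 0 := by
    rw [hx_def]
    exact (map_ne_zero_iff ι₀.symm ι₀.symm.injective).mpr hb0
  have hxpos : 0 < ‖x‖ := norm_pos_iff.mpr hx0
  have hℓ1 : (1 : ℝ) < (ℓ : ℝ) := by exact_mod_cast (Fact.out : ℓ.Prime).one_lt
  obtain ⟨k, hk⟩ := pow_unbounded_of_one_lt ‖x‖⁻¹ hℓ1
  -- the transcendental `c = b / ℓ^k` and an automorphism `σ` of `ℂ` with `σ c = b`
  set c : ℂ := b / (ℓ : ℂ) ^ k with hc_def
  have hℓC : ((ℓ : ℂ) ^ k) ≠ 0 := pow_ne_zero _ (Nat.cast_ne_zero.mpr (Fact.out : ℓ.Prime).ne_zero)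
  have hc : Transcendental ℚ c := by
    intro halg
    have hmul : IsAlgebraic ℚ (c * (ℓ : ℂ) ^ k) := halg.mul ((isAlgebraic_nat ℓ).pow k)
    rw [hc_def, div_mul_cancel₀ _ hℓC] at hmul
    exact hb hmul
  obtain ⟨σ, hσ⟩ :=
    Literature.FieldTheory.AlgClosed.Complex.exists_ringEquiv_apply_eq_of_transcendental hc hb
  have hσ' : σ.symm b = c := by
    rw [← hσ, RingEquiv.symm_apply_apply]
  -- the twisted isomorphism `ι' = σ ∘ ι₀`
  have hle := h (ι₀.trans σ)
  have hval : (ι₀.trans σ).symm b = x / (ℓ : PadicAlgCl ℓ) ^ k := by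
    rw [RingEquiv.symm_trans_apply, hσ', hc_def, map_div₀, map_pow, map_natCast]
  rw [hval, norm_div, norm_pow, norm_natCast_padicAlgCl ℓ, inv_pow, div_inv_eq_mul] at hle
  -- `‖x‖ · ℓ^k > 1`
  have hgt : 1 < ‖x‖ * (ℓ : ℝ) ^ k := by
    have h1 : ‖x‖⁻¹ * ‖x‖ = 1 := inv_mul_cancel₀ hxpos.ne'
    calc (1 : ℝ) = ‖x‖ * ‖x‖⁻¹ := by rw [mul_comm, h1]
      _ < ‖x‖ * (ℓ : ℝ) ^ k := mul_lt_mul_of_pos_left hk hxpos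
  exact absurd hle (not_le.mpr hgt)


/-! ### Eigenvalues of a compact-image representation have norm `≤ 1` (Serre 1968, Ch. I §1.1)

Private re-proofs (suffix `_lar`) of `Literature.NumberTheory.GaloisRepresentations.CompactImageCharpolyIntegral`:
`norm_le_one_of_isRoot_charpoly_of_pow_bounded`, `FramedRep.exists_forall_norm_apply_le`,
`FramedRep.norm_le_one_of_isRoot_charpoly` — kept private so that nothing clashes if that module enters the
import closure. -/

section CompactImage

variable {A : Type*} [NormedField A] {m : Type*} [Fintype m] [DecidableEq m]

omit [DecidableEq m] in
/-- Operator-norm style bound: if every entry of `N` has norm `≤ C` then `‖N *ᵥ v‖ ≤ card m · C · ‖v‖` (sup norms). -/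
private theorem norm_mulVec_le_of_forall_norm_le_lar {N : Matrix m m A} {C : ℝ} (hC : 0 ≤ C)
    (h : ∀ i j, ‖N i j‖ ≤ C) (w : m → A) :
    ‖N *ᵥ w‖ ≤ Fintype.card m * C * ‖w‖ := by
  refine (pi_norm_le_iff_of_nonneg (by positivity)).mpr fun i => ?_
  calc ‖(N *ᵥ w) i‖ = ‖∑ j, N i j * w j‖ := rfl
    _ ≤ ∑ j, ‖N i j * w j‖ := norm_sum_le _ _
    _ ≤ ∑ _j : m, C * ‖w‖ := Finset.sum_le_sum fun j _ => by
        rw [norm_mul]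
        exact mul_le_mul (h i j) (norm_le_pi_norm w j) (norm_nonneg _) hC
    _ = Fintype.card m * C * ‖w‖ := by
        rw [Finset.sum_const, Finset.card_univ, nsmul_eq_mul]
        ring

/-- Powers act on an eigenvector by powers of the eigenvalue: `N v = μ v ⇒ Nᵏ v = μᵏ v`. -/
private theorem pow_mulVec_eq_pow_smul_lar {N : Matrix m m A} {μ : A} {v : m → A}
    (hv : N *ᵥ v = μ • v) (k : ℕ) : (N ^ k) *ᵥ v = μ ^ k • v := by
  induction k with
  | zero => simp
  | succ k ih =>
    rw [pow_succ, ← Matrix.mulVec_mulVec, hv, Matrix.mulVec_smul, ih, smul_smul, ← pow_succ']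

/-- Eigenvalues of a power-bounded matrix have norm at most `1`. [cite: SerreAbelianLadic1968, Ch. I §1.1] -/
private theorem norm_le_one_of_isRoot_charpoly_of_pow_bounded_lar {N : Matrix m m A} {C : ℝ}
    (hC : ∀ k : ℕ, ∀ i j, ‖(N ^ k) i j‖ ≤ C) {μ : A} (hμ : N.charpoly.IsRoot μ) : ‖μ‖ ≤ 1 := by
  have hev : Module.End.HasEigenvalue (Matrix.toLin' N) μ := by
    rw [Module.End.hasEigenvalue_iff_isRoot_charpoly, Matrix.charpoly_toLin']
    exact hμ
  obtain ⟨v, hv⟩ := hev.exists_hasEigenvector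
  have hv0 : v ≠ 0 := hv.2
  have hNv : N *ᵥ v = μ • v := by
    have h := hv.apply_eq_smul
    rwa [Matrix.toLin'_apply] at h
  have hvpos : 0 < ‖v‖ := norm_pos_iff.mpr hv0
  have hm : Nonempty m := by
    by_contra h
    rw [not_nonempty_iff] at h
    exact hv0 (Subsingleton.elim _ _)
  obtain ⟨i₀⟩ := hm
  have hC0 : 0 ≤ C := (norm_nonneg _).trans (hC 0 i₀ i₀)
  have hbound : ∀ k : ℕ, ‖μ‖ ^ k ≤ Fintype.card m * C := by
    intro k
    have h1 : ‖(N ^ k) *ᵥ v‖ ≤ Fintype.card m * C * ‖v‖ :=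
      norm_mulVec_le_of_forall_norm_le_lar hC0 (hC k) v
    rw [pow_mulVec_eq_pow_smul_lar hNv, norm_smul, norm_pow] at h1
    exact le_of_mul_le_mul_right h1 hvpos
  by_contra hlt
  rw [not_le] at hlt
  obtain ⟨k, hk⟩ := pow_unbounded_of_one_lt (Fintype.card m * C) hlt
  exact absurd (hbound k) (not_le.mpr hk)

variable {G : Type*} [Group G] [TopologicalSpace G] [CompactSpace G] {d : ℕ}

/-- The matrix entries of a continuous representation of a COMPACT group are uniformly bounded. [folklore] -/
private theorem exists_forall_norm_apply_le_lar (ρ : FramedRep G A d) :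
    ∃ C : ℝ, ∀ (g : G) (i j : Fin d), ‖((ρ g : GL (Fin d) A) : Matrix (Fin d) (Fin d) A) i j‖ ≤ C := by
  set f : G → (Fin d → Fin d → A) :=
    fun g i j => ((ρ g : GL (Fin d) A) : Matrix (Fin d) (Fin d) A) i j with hf_def
  have hf : Continuous f := by
    refine continuous_pi fun i => continuous_pi fun j => ?_
    exact (Units.continuous_val.comp (map_continuous ρ)).matrix_elem i j
  obtain ⟨C, hC⟩ := isCompact_univ.exists_bound_of_continuousOn hf.continuousOn
  refine ⟨C, fun g i j => ?_⟩
  exact ((norm_le_pi_norm (f g i) j).trans (norm_le_pi_norm (f g) i)).trans (hC g (Set.mem_univ g))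

/-- **Every eigenvalue of `ρ(g)` has norm `≤ 1`** for a continuous representation of a compact group over
a normed field (the powers `ρ(g)^k = ρ(g^k)` stay in the bounded image).
[cite: SerreAbelianLadic1968, Ch. I §1.1] -/
private theorem norm_le_one_of_isRoot_charpoly_lar (ρ : FramedRep G A d) (g : G) {μ : A}
    (hμ : (FramedRep.charpoly ρ g).IsRoot μ) : ‖μ‖ ≤ 1 := by
  obtain ⟨C, hC⟩ := exists_forall_norm_apply_le_lar ρ
  refine norm_le_one_of_isRoot_charpoly_of_pow_bounded_lar
    (N := ((ρ g : GL (Fin d) A) : Matrix (Fin d) (Fin d) A)) (C := C) (fun k i j => ?_) hμ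
  have h : ((ρ g : GL (Fin d) A) : Matrix (Fin d) (Fin d) A) ^ k =
      ((ρ (g ^ k) : GL (Fin d) A) : Matrix (Fin d) (Fin d) A) := by
    rw [map_pow, Units.val_pow_eq_pow_val]
  rw [h]
  exact hC (g ^ k) i j

end CompactImage

/-! ### The unit bounds: Satake parameters seen through any `ι` are `ℓ`-adically integral -/

variable {F : Type} [Field F] [NumberField F] {ℓ : ℕ} [Fact ℓ.Prime] {n : ℕ}

/-- **Rank `n ≥ 2`: local–global compatibility at `v ∤ ℓ` makes `ι⁻¹(a)` an eigenvalue of `ρ` at the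
recipe Frobenius, hence an `ℓ`-adic integer.**  With `u = 1` the Grothendieck–Deligne recipe reads
`[r_v.ρ(Φ)] = ρ(Φ)`; transporting along `ι` and passing to the Frobenius-semisimplification `r'` (class
`rec_v(π_v)`) does not change the characteristic polynomial, which the unconditional rank-`n` unramified
computation identifies as `∏_{b ∈ α} (X - b)` (`LocalLanglandsDatum.recGL_unramified_of_hasSatakeParamAt`);
eigenvalues of a compact-image representation have norm `≤ 1`.
[cite: TateCorvallis1979, (4.2.1)] [cite: CarayolASENS1986, Thm. (A)] [cite: SerreAbelianLadic1968, Ch. I §2.3] -/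
theorem norm_symm_le_one_of_localGlobalCompatibleAt (hn : 1 < n) (R : ReciprocityData F)
    {hcpt : isCompact_glFiniteIntegralLevel n F} (ι : PadicAlgCl ℓ ≃+* ℂ)
    (π : CuspidalAutomorphicRepData n F hcpt) (ρ : FramedGaloisRep F (PadicAlgCl ℓ) n)
    {v : HeightOneSpectrum (𝓞 F)} (hv : ((ℓ : ℕ) : 𝓞 F) ∉ v.asIdeal) {α : Multiset ℂ}
    (hα : π.1.HasSatakeParamAt v α) (hLG : LocalGlobalCompatibleAt R ι π.1 ρ v) {a : ℂ} (ha : a ∈ α) :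
    ‖ι.symm a‖ ≤ 1 := by
  obtain ⟨πv, rv, rℂ, hloc, hWD, -, hT, r', hr', hc⟩ := hLG
  -- the unconditional unramified computation of `rec_v(π_v)` in rank `n ≥ 2`
  obtain ⟨-, -, hchar'⟩ := LocalLanglandsDatum.recGL_unramified_of_hasSatakeParamAt hn hcpt π v α hα
    (R.llc v) πv hloc r' hr'.isFrobSemisimple hc.symm
  -- the recipe Frobenius `Φ`
  obtain ⟨t, U, Φ, -, -, hΦ, -, -, hrec⟩ := hWD hv
  -- `char(rℂ.ρ Φ) = ∏ (X - b)` (F-semisimplification does not change characteristic polynomials)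
  have hss : (rℂ.ρ Φ).charpoly = (α.map fun b => X - C b).prod := by
    obtain ⟨-, m, hm, hcm, hsum⟩ := hr'.2.2 Φ
    rw [hsum, LinearMap.charpoly_add_eq_of_isNilpotent_of_commute hm hcm, hchar' Φ hΦ]
  -- the recipe at `u = 1`: `[rv.ρ Φ] = ρ(Φ)`
  set g : absoluteGaloisGroup F :=
    absGaloisRestrict F (v.adicCompletion F) (WeilGroup.toAbsGalois (v.adicCompletion F) Φ) with hg
  have hmat : LinearMap.toMatrix' (rv.ρ Φ) =
      ((ρ g : GL (Fin n) (PadicAlgCl ℓ)) : Matrix (Fin n) (Fin n) (PadicAlgCl ℓ)) := by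
    have h1 := hrec 1 1
    simp only [zpow_one, OneMemClass.coe_one, mul_one, map_one, toAdd_one, zero_smul, neg_zero,
      IsNilpotent.exp_zero] at h1
    rw [h1, FramedRep.toWeilGroupHom_apply, FramedGaloisRep.toLocal_apply]
  -- `ι (char ρ(g)) = ∏ (X - b)`
  have hmapch : (FramedRep.charpoly ρ g).map (ι : PadicAlgCl ℓ →+* ℂ) = (α.map fun b => X - C b).prod := by
    rw [← hss, charpoly_eq_charpoly_toMatrix', hT.1 Φ, hmat, Matrix.charpoly_map]
    rfl
  -- `ι⁻¹(a)` is a root of `char ρ(g)`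
  have hroot : (FramedRep.charpoly ρ g).IsRoot (ι.symm a) := by
    refine Polynomial.IsRoot.of_map (f := (ι : PadicAlgCl ℓ →+* ℂ)) ?_
      (ι : PadicAlgCl ℓ →+* ℂ).injective
    have hιa : (ι : PadicAlgCl ℓ →+* ℂ) (ι.symm a) = a := ι.apply_symm_apply a
    rw [hιa, hmapch, Polynomial.IsRoot.def, Polynomial.eval_multiset_prod, Multiset.prod_eq_zero_iff,
      Multiset.map_map]
    exact Multiset.mem_map.mpr ⟨a, ha, by simp⟩
  haveI : CompactSpace (absoluteGaloisGroup F) := absoluteGaloisGroup_compactSpace F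
  exact norm_le_one_of_isRoot_charpoly_lar ρ g hroot

/-- **A Satake–Frobenius compatible `ρ` makes `ι⁻¹(a⁻¹)` an `ℓ`-adic integer** for every entry `a`
of the Satake parameter: `char ρ(Frob_v^{arith}) = ∏ (X - ι⁻¹(b⁻¹))` at an arithmetic Frobenius
(which exists), and eigenvalues of a compact-image representation have norm `≤ 1`.  (Used in rank `1`.)
[cite: SerreAbelianLadic1968, Ch. I §2.3] [cite: BuzzardGeeLMS2014, Conj. 3.2.1] -/
theorem norm_symm_inv_le_one_of_satakeFrobCompatibleAt {hcpt : isCompact_glFiniteIntegralLevel n F}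
    (ι : PadicAlgCl ℓ ≃+* ℂ) (π : AutomorphicRepData (AutomorphyDatum.gl n F hcpt))
    (ρ : FramedGaloisRep F (PadicAlgCl ℓ) n) {v : HeightOneSpectrum (𝓞 F)} {α : Multiset ℂ}
    (hα : π.HasSatakeParamAt v α) (hsat : SatakeFrobCompatibleAt ι π ρ v) {a : ℂ} (ha : a ∈ α) :
    ‖ι.symm a⁻¹‖ ≤ 1 := by
  obtain ⟨α', hα', -, hcp⟩ := hsat
  obtain rfl : α = α' := AutomorphicRepData.hasSatakeParamAt_unique_holds π hα hα'
  obtain ⟨𝔓, h𝔓⟩ := IsDedekindDomain.HeightOneSpectrum.primesAbove_nonempty v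
  obtain ⟨σ, hσ⟩ :=
    IsDedekindDomain.HeightOneSpectrum.exists_isArithFrobAt_of_mem_primesAbove_holds h𝔓
  have hch : FramedRep.charpoly ρ σ = arithFrobPolyOfSatake ι v.residueCard 1 α := hcp 𝔓 h𝔓 σ hσ
  haveI : CompactSpace (absoluteGaloisGroup F) := absoluteGaloisGroup_compactSpace F
  refine norm_le_one_of_isRoot_charpoly_lar ρ σ ?_
  rw [hch]
  refine Polynomial.isRoot_of_mem_roots ?_
  rw [roots_arithFrobPolyOfSatake]
  exact Multiset.mem_map.mpr ⟨a, ha, by simp⟩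

/-- **Open form of the item.**  Under (A) (for all `ι : ℚ̄_ℓ ≃ ℂ`, one prime `ℓ`), the Satake
parameters of an L-algebraic cuspidal `π` of `GL_n(𝔸_F)` are algebraic at every place `v ∤ ℓ`:
rank `≥ 2` by the unit bound on `ι⁻¹(a)` from local–global compatibility, rank `1` by the unit bound
on `ι⁻¹(a⁻¹)` from Weil's character, both for all `ι`, then Steinitz.
[cite: BuzzardGeeLMS2014, Conj. 3.1.6, 3.2.1–3.2.2] [cite: Weil1956, §1] -/
theorem isAlgebraic_satake_of_automorphicToGalois (ℓ : ℕ) [Fact ℓ.Prime] {R : ReciprocityData F}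
    {hcpt : isCompact_glFiniteIntegralLevel n F} (hAG : AutomorphicToGalois n R hcpt)
    (π : CuspidalAutomorphicRepData n F hcpt) (hL : π.1.IsLAlgebraic)
    {v : HeightOneSpectrum (𝓞 F)} (hv : ((ℓ : ℕ) : 𝓞 F) ∉ v.asIdeal) {α : Multiset ℂ}
    (hα : π.1.HasSatakeParamAt v α) {a : ℂ} (ha : a ∈ α) : IsAlgebraic ℚ a := by
  rcases Nat.lt_or_ge 1 n with hn | hn
  · -- rank `n ≥ 2`: local–global compatibility at `v` of the `ρ_{π,ι}` of (A), for every `ι`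
    refine isAlgebraic_of_forall_norm_symm_le_one ℓ fun ι => ?_
    obtain ⟨ρ, -, -, hcorr, -⟩ := hAG π hL ℓ ι
    exact norm_symm_le_one_of_localGlobalCompatibleAt hn R ι π ρ hv hα (hcorr.2 v) ha
  · -- rank `1` (`n = 0` is excluded by `card α = n`, `a ∈ α`): Weil's character, for every `ι`
    have hcard : Multiset.card α = n := hα.card_eq
    have hpos : 0 < Multiset.card α := Multiset.card_pos_iff_exists_mem.mpr ⟨a, ha⟩
    obtain rfl : n = 1 := le_antisymm hn (by omega)
    have halg : IsAlgebraic ℚ a⁻¹ := by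
      refine isAlgebraic_of_forall_norm_symm_le_one ℓ fun ι => ?_
      obtain ⟨ρ, -, hρ, -⟩ := stub_rankOne_corresponds_away_unramified F ℓ hcpt R ι π hL
      exact norm_symm_inv_le_one_of_satakeFrobCompatibleAt ι π.1 ρ hα (hρ v hv ⟨α, hα⟩).1 ha
    exact IsAlgebraic.inv_iff.mp halg

end LArithmeticOfAutToGal

/-- **Item `stmt-Langlands-1066` BY NAME: `LiftDescend.LArithmeticOfAutToGal` holds.**  Direction (A)
of the summit for `GL_n` over `F` (for all `ι : ℚ̄_ℓ ≃ ℂ`) implies that every L-algebraic cuspidal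
`π` of `GL_n(𝔸_F)` has algebraic Satake parameters at all places `v ∤ 2` (a cofinite set):
compact Galois image makes every `ι⁻¹(a)` (resp. `ι⁻¹(a⁻¹)` in rank `1`) an `ℓ`-adic integer, and `Aut(ℂ)`
moves a transcendental number onto its quotient by `2^k` (Steinitz).
[cite: BuzzardGeeLMS2014, Conj. 3.1.6, 3.2.1–3.2.2] [cite: SerreAbelianLadic1968, Ch. I §2.3] -/
theorem lArithmeticOfAutToGal_proof :
    Summit.Langlands.Langlands.Theses.LiftDescend.LArithmeticOfAutToGal := by
  intro F _ _ R n hcpt hAG π hL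
  haveI : Fact (Nat.Prime 2) := ⟨Nat.prime_two⟩
  filter_upwards [FramedGaloisRep.eventually_natCast_not_mem F 2] with v hv
  intro α hα a ha
  exact LArithmeticOfAutToGal.isAlgebraic_satake_of_automorphicToGalois 2 hAG π hL hv hα ha

end Summit.Langlands.Langlands.Theorems

end
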